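import Summits.AtomisticToContinuum.HydrodynamicLimit.Theorems.MourreKoopmanChargesLinearToEntropyInBandFastCollisionThroughputOfEnvelope
import Summits.AtomisticToContinuum.HydrodynamicLimit.Theorems.ImplosionDichotomyHydroLimitInBandWindowContinuityTransfer
import HarnessLib

/-!
# Crux `MourreKoopmanCharges.LinearToEntropyInBand` (stmt-AtomisticToContinuum-17740), line `registered`:
# wave-3 consolidation, PREP — mean window activity from a pair envelope

Helper file (`--supports stmt-AtomisticToContinuum-17740`).  In skeleton v5 the by-name input stub 4b,
`TwoClocks.TransferActivityTails` (stmt-16624, OPEN), is consumed only through the guarded window continuity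
`|H_N(s') − H_N(s)| ≤ (N+1) ε` over micro windows (`LTEInBand.glue_windowContinuityInBandBelow_of_tails`, via
CAT 13734 ∧ CEAT), where the two activity-tail inputs of `HydroLimitInBandContinuity.abs_klDiv_window_sub_le`
are used at ONE level, i.e. only through a MEAN window-activity bound `E[Σᵢ aᵢ(s, s + w)] = O(N+1)`,
`w = τ (N+1)^{-1/3}`.  This file supplies that input from a PAIR ENVELOPE of the law at the times of the
window (the sequel `…ContinuityOfEnvelope` feeds it with the Lanford envelope `BGEndpointRigidity.LanfordEnvelopeR`,
stmt-13677, making stub 4b replaceable by stub 3's head):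

* §1 kinematics of a record read off a configuration: the momentum jump of the first partner is at most
  the relative speed `‖v − w‖` of the (post-collisional) pair, its energy jump at most `‖v − w‖ (‖v‖ + ‖w‖)`
  (elastic law: the jump is the normal component of `v − w`; energy conservation of the pair);
* §2 `ofReal_sum_collisionSum_le_finsum_mark`: along a good orbit the per-particle window activities of a
  record functional dominated by a velocity mark `b` sum to at most the inline contact-pair sum of `b` over
  the closed window; the registered main lemma `glue_activityTailZero_of_pairEnvelope`: under any law carried
  by the good set with a pair envelope at the times of the window (the non-stationary one-window / Campbell
  inequality `CollisionEnergyExchangeMeanBound.lintegral_windowCollisionSum_le_of_pairEnvelope`, CIP 1994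
  App. 4.A) the CAT/CEAT-SHAPED hypothesis of `abs_klDiv_window_sub_le` holds at level `V = 0` with any rate
  `κ` normalising the mean, `κ · 4 C w (N+1)² ε_N² J ≤ N + 1`.

No definitions; nothing here restates the crux, the route's items or the Statement.  References:
C. Cercignani, R. Illner, M. Pulvirenti, *The Mathematical Theory of Dilute Gases* (1994) §4.2, App. 4.A;
H.-T. Yau, Lett. Math. Phys. 22 (1991) §2.
-/

noncomputable section

open MeasureTheory Filter Set Topology
open scoped ENNReal InnerProductSpace BigOperators

namespace Summit.AtomisticToContinuum.HydrodynamicLimit.Theorems.LTEInBand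

open Literature.MathematicalPhysics.KineticTheory Literature.Analysis.FluidPDE
open Literature.Analysis.FunctionSpaces
open Summit.AtomisticToContinuum.HydrodynamicLimit.Theorems.HydroLimitInBandContinuity (collisionSum_nonneg')

/-! ## §1 Kinematics of a record read off a configuration -/

/-- **Momentum jump of the first partner.** For the record of the ordered pair `(k, l)`, `k ≠ l`, read
off a configuration `z` (post-collisional velocities `(v, w) = ((z k).2, (z l).2)`, pre-collisional ones by
the elastic reflection), `‖v⁺ − v⁻‖ ≤ ‖v − w‖`: the jump is the normal component of `v − w`
(`norm_collidePair_vel_sub`). -/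
theorem norm_ofConfig_postVel_sub_preVel_le {n : ℕ} (G : Geometry (Fin 3) T3) (ε : ℝ)
    (z : Config n (Fin 3) T3) (t : ℝ) {k l : Fin n} (hkl : k ≠ l) :
    ‖(HardSphereCollisionRecord.ofConfig G ε z t k l).postVel.1 -
        (HardSphereCollisionRecord.ofConfig G ε z t k l).preVel.1‖ ≤ ‖(z k).2 - (z l).2‖ := by
  rw [HardSphereCollisionRecord.ofConfig_preVel_eq_collidePair G ε z t hkl,
    HardSphereCollisionRecord.ofConfig_postVel]
  dsimp only
  rw [norm_sub_rev, norm_collidePair_vel_sub hkl]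
  exact abs_inner_div_norm_le_norm _ _

/-- **Energy jump of the first partner.** In the same situation,
`|‖v⁺‖² − ‖v⁻‖²| / 2 ≤ ‖v − w‖ (‖v‖ + ‖w‖)`: `|‖v⁺‖² − ‖v⁻‖²| = |‖v⁺‖ − ‖v⁻‖| (‖v⁺‖ + ‖v⁻‖)`, the first
factor is at most the jump `≤ ‖v − w‖`, and energy conservation of the pair bounds `‖v⁻‖` by `‖v‖ + ‖w‖`. -/
theorem abs_energyJump_ofConfig_le {n : ℕ} (G : Geometry (Fin 3) T3) (ε : ℝ)
    (z : Config n (Fin 3) T3) (t : ℝ) {k l : Fin n} (hkl : k ≠ l) :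
    |‖(HardSphereCollisionRecord.ofConfig G ε z t k l).postVel.1‖ ^ 2 -
        ‖(HardSphereCollisionRecord.ofConfig G ε z t k l).preVel.1‖ ^ 2| / 2 ≤
      ‖(z k).2 - (z l).2‖ * (‖(z k).2‖ + ‖(z l).2‖) := by
  have hj := norm_ofConfig_postVel_sub_preVel_le G ε z t hkl
  have hE := HardSphereCollisionRecord.ofConfig_norm_sq_preVel G ε z t k l
  rw [HardSphereCollisionRecord.ofConfig_postVel] at hj hE ⊢
  dsimp only at hj hE ⊢
  set p : V3 := (HardSphereCollisionRecord.ofConfig G ε z t k l).preVel.1 with hp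
  set a : V3 := (z k).2 with ha
  set b : V3 := (z l).2 with hb
  have ha0 := norm_nonneg a
  have hb0 := norm_nonneg b
  have hp0 := norm_nonneg p
  have hpE : ‖p‖ ^ 2 ≤ (‖a‖ + ‖b‖) ^ 2 := by nlinarith [sq_nonneg ‖(HardSphereCollisionRecord.ofConfig G ε z t k l).preVel.2‖]
  have hpB : ‖p‖ ≤ ‖a‖ + ‖b‖ := (abs_le_of_sq_le_sq' hpE (by positivity)).2
  have h1 : |‖a‖ - ‖p‖| ≤ ‖a - b‖ := (abs_norm_sub_norm_le a p).trans hj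
  calc |‖a‖ ^ 2 - ‖p‖ ^ 2| / 2 = |‖a‖ - ‖p‖| * (‖a‖ + ‖p‖) / 2 := by
        rw [sq_sub_sq, abs_mul, abs_of_nonneg (add_nonneg ha0 hp0)]
        ring
    _ ≤ ‖a - b‖ * (‖a‖ + (‖a‖ + ‖b‖)) / 2 := by gcongr
    _ ≤ ‖a - b‖ * (‖a‖ + ‖b‖) := by nlinarith [norm_nonneg (a - b)]

/-! ## §2 Mean window activity from a pair envelope -/

/-- **Pathwise bookkeeping.** Along a good orbit of the flow, for a record functional `g` dominated on
records read off configurations by a nonnegative mark `b` of the two post-collisional velocities, the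
per-particle window activities `Σ_{c : c.fst = i, c.time ∈ (s₁, s₁ + w]} g c` sum over `i` to at most the
inline contact-pair sum of `b` over the collision times of the CLOSED window `[s₁, s₁ + w]` (the form of
`lintegral_windowCollisionSum_le_of_pairEnvelope`; honest finite sums on the good set). -/
theorem ofReal_sum_collisionSum_le_finsum_mark {σ : ℝ} {N : ℕ}
    (Φ : HardSphereFlow (Torus.geometry (Fin 3)) (hsDiameter σ N) (N + 1))
    {z : Config (N + 1) (Fin 3) T3} (hz : z ∈ Φ.good)
    {g : HardSphereCollisionRecord (Fin 3) T3 (N + 1) → ℝ} {b : V3 × V3 → ℝ} (hb0 : ∀ p, 0 ≤ b p)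
    (hgb : ∀ (y : Config (N + 1) (Fin 3) T3) (t : ℝ) (k l : Fin (N + 1)), k ≠ l →
      g (HardSphereCollisionRecord.ofConfig (Torus.geometry (Fin 3)) (hsDiameter σ N) y t k l) ≤
        b ((y k).2, (y l).2))
    {s₁ w : ℝ} (hw : 0 ≤ w) :
    ENNReal.ofReal (∑ i : Fin (N + 1),
        Φ.collisionSum (Ioc s₁ (s₁ + w)) (fun c => if c.fst = i then g c else 0) z) ≤
      ∑ᶠ s ∈ collisionTimes (Torus.geometry (Fin 3)) (hsDiameter σ N) (fun t => Φ.flow t z) ∩ Icc s₁ (s₁ + w),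
        ∑ i : Fin (N + 1), ∑ j : Fin (N + 1),
          (if i ≠ j ∧ ‖(Torus.geometry (Fin 3)).sepVec (Φ.flow s z i).1 (Φ.flow s z j).1‖ = hsDiameter σ N
            then ENNReal.ofReal (b ((Φ.flow s z i).2, (Φ.flow s z j).2)) else 0) := by
  classical
  have htraj := Φ.isTrajectory z hz
  have hfinO : (collisionTimes (Torus.geometry (Fin 3)) (hsDiameter σ N) (fun t => Φ.flow t z) ∩ Ioc s₁ (s₁ + w)).Finite :=
    Φ.finite_collisionTimes_inter hz Ioc_subset_Icc_self
  have hfinC : (collisionTimes (Torus.geometry (Fin 3)) (hsDiameter σ N) (fun t => Φ.flow t z) ∩ Icc s₁ (s₁ + w)).Finite :=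
    htraj.locFinite s₁ (s₁ + w)
  have hfin1 : (collisionTimes (Torus.geometry (Fin 3)) (hsDiameter σ N) (fun t => Φ.flow t z) ∩ {s₁}).Finite :=
    (Set.finite_singleton s₁).subset inter_subset_right
  -- (a) the particle sum collapses the indicator of the first partner
  have hA : ∑ i : Fin (N + 1), Φ.collisionSum (Ioc s₁ (s₁ + w)) (fun c => if c.fst = i then g c else 0) z =
      collisionPairSum (Torus.geometry (Fin 3)) (hsDiameter σ N) (fun t => Φ.flow t z) (Ioc s₁ (s₁ + w))
        (fun t k l => g (HardSphereCollisionRecord.ofConfig (Torus.geometry (Fin 3)) (hsDiameter σ N) (Φ.flow t z) t k l)) := by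
    rw [collisionPairSum_eq_finset_sum hfinO]
    simp only [HardSphereFlow.collisionSum_eq, collisionSum_eq_finset_sum hfinO,
      HardSphereCollisionRecord.ofConfig_fst]
    rw [Finset.sum_comm]
    refine Finset.sum_congr rfl fun t _ => ?_
    rw [Finset.sum_comm]
    refine Finset.sum_congr rfl fun p _ => ?_
    rw [Finset.sum_ite_eq, if_pos (Finset.mem_univ _)]
  -- (b) marks, and the closed window
  have hB : collisionPairSum (Torus.geometry (Fin 3)) (hsDiameter σ N) (fun t => Φ.flow t z) (Ioc s₁ (s₁ + w))
        (fun t k l => g (HardSphereCollisionRecord.ofConfig (Torus.geometry (Fin 3)) (hsDiameter σ N) (Φ.flow t z) t k l)) ≤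
      collisionPairSum (Torus.geometry (Fin 3)) (hsDiameter σ N) (fun t => Φ.flow t z) (Icc s₁ (s₁ + w))
        (fun t k l => b ((Φ.flow t z k).2, (Φ.flow t z l).2)) := by
    calc collisionPairSum (Torus.geometry (Fin 3)) (hsDiameter σ N) (fun t => Φ.flow t z) (Ioc s₁ (s₁ + w))
          (fun t k l => g (HardSphereCollisionRecord.ofConfig (Torus.geometry (Fin 3)) (hsDiameter σ N) (Φ.flow t z) t k l))
        ≤ collisionPairSum (Torus.geometry (Fin 3)) (hsDiameter σ N) (fun t => Φ.flow t z) (Ioc s₁ (s₁ + w))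
            (fun t k l => b ((Φ.flow t z k).2, (Φ.flow t z l).2)) :=
          collisionPairSum_mono hfinO fun t _ p hp => hgb _ _ _ _ (mem_contactPairs.1 hp).1
      _ ≤ collisionPairSum (Torus.geometry (Fin 3)) (hsDiameter σ N) (fun t => Φ.flow t z) (Icc s₁ (s₁ + w))
            (fun t k l => b ((Φ.flow t z k).2, (Φ.flow t z l).2)) := by
          rw [← Ioc_union_left (le_add_of_nonneg_right hw), collisionPairSum_union hfinO hfin1
            (disjoint_singleton_right.2 fun h => lt_irrefl _ h.1)]
          exact le_add_of_nonneg_right (collisionPairSum_nonneg fun _ _ _ => hb0 _)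
  -- (c) the inline `ℝ≥0∞` form
  have h0 : ∀ (r : ℝ) (i k : Fin (N + 1)), (0 : ℝ) ≤
      (if i ≠ k ∧ ‖(Torus.geometry (Fin 3)).sepVec (Φ.flow r z i).1 (Φ.flow r z k).1‖ = hsDiameter σ N
        then b ((Φ.flow r z i).2, (Φ.flow r z k).2) else 0) := fun r i k => by
    split_ifs
    exacts [hb0 _, le_rfl]
  calc ENNReal.ofReal (∑ i : Fin (N + 1),
        Φ.collisionSum (Ioc s₁ (s₁ + w)) (fun c => if c.fst = i then g c else 0) z)
      ≤ ENNReal.ofReal (collisionPairSum (Torus.geometry (Fin 3)) (hsDiameter σ N) (fun t => Φ.flow t z) (Icc s₁ (s₁ + w))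
          (fun t k l => b ((Φ.flow t z k).2, (Φ.flow t z l).2))) := by
        rw [hA]
        exact ENNReal.ofReal_le_ofReal hB
    _ = _ := by
        rw [collisionPairSum_eq_finsum_ite htraj.mem, finsum_mem_eq_finite_toFinset_sum _ hfinC,
          finsum_mem_eq_finite_toFinset_sum _ hfinC,
          ENNReal.ofReal_sum_of_nonneg fun r _ => Finset.sum_nonneg fun i _ =>
            Finset.sum_nonneg fun k _ => h0 r i k]
        refine Finset.sum_congr rfl fun r _ => ?_
        rw [ENNReal.ofReal_sum_of_nonneg fun i _ => Finset.sum_nonneg fun k _ => h0 r i k]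
        refine Finset.sum_congr rfl fun i _ => ?_
        rw [ENNReal.ofReal_sum_of_nonneg fun k _ => h0 r i k]
        refine Finset.sum_congr rfl fun k _ => ?_
        rw [apply_ite ENNReal.ofReal, ENNReal.ofReal_zero]

/-- **Registered main lemma `glue_activityTailZero_of_pairEnvelope` (wave 3): the tail-shaped activity bound at
level `0`, from a pair envelope at the times of the window.** For a
flow `Φ` of `N + 1` spheres of diameter `ε_N`, a law `P` carried by the good set whose pair marginals at the
times `r ∈ [s₁, s₁ + w]` (`0 < w`) are dominated by `C · (Haar ⊗ γ)^{⊗2}`, a nonnegative record functional `g`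
dominated by a measurable nonnegative velocity mark `b` with Gaussian-type flux bound
`∫ ‖w − v‖ b dγ dγ ≤ J`, and a rate `0 ≤ κ` with `κ · 4 C w (N+1)² ε_N² J ≤ N + 1`: the hypothesis `hCATb` /
`hCEATb` of `HydroLimitInBandContinuity.abs_klDiv_window_sub_le` holds with `V = 0`,
`E_P[(N+1)⁻¹ Σᵢ 𝟙{0 < κ aᵢ} κ aᵢ] ≤ 1`, `aᵢ = Σ_{c : c.fst = i, c.time ∈ (s₁, s₁ + w]} g c`
(`ofReal_sum_collisionSum_le_finsum_mark` in mean and `lintegral_windowCollisionSum_le_of_pairEnvelope`).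
[cite: CIP1994, App. 4.A] -/
theorem glue_activityTailZero_of_pairEnvelope : ∀ {σ : ℝ}, 0 < σ → ∀ {N : ℕ} (Φ : Literature.Analysis.FluidPDE.HardSphereFlow (Literature.Analysis.FluidPDE.Torus.geometry (Fin 3)) (Literature.MathematicalPhysics.KineticTheory.hsDiameter σ N) (N + 1)) (P : MeasureTheory.Measure (Literature.Analysis.FluidPDE.Config (N + 1) (Fin 3) Literature.MathematicalPhysics.KineticTheory.T3)), P Φ.goodᶜ = 0 → ∀ {s₁ w : ℝ}, 0 < w → ∀ {C : ℝ}, 0 ≤ C → ∀ (γ : MeasureTheory.Measure Literature.MathematicalPhysics.KineticTheory.V3) [MeasureTheory.SFinite γ], (∀ r ∈ Set.Icc s₁ (s₁ + w), ∀ i j : Fin (N + 1), i ≠ j → ∀ f : (Literature.MathematicalPhysics.KineticTheory.T3 × Literature.MathematicalPhysics.KineticTheory.V3) × (Literature.MathematicalPhysics.KineticTheory.T3 × Literature.MathematicalPhysics.KineticTheory.V3) → ENNReal, Measurable f → ∫⁻ z, f (Φ.flow r z i, Φ.flow r z j) ∂P ≤ ENNReal.ofReal C * ∫⁻ q, f q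 ∂(((MeasureTheory.volume : MeasureTheory.Measure Literature.MathematicalPhysics.KineticTheory.T3).prod γ).prod ((MeasureTheory.volume : MeasureTheory.Measure Literature.MathematicalPhysics.KineticTheory.T3).prod γ))) → ∀ {g : Literature.Analysis.FluidPDE.HardSphereCollisionRecord (Fin 3) Literature.MathematicalPhysics.KineticTheory.T3 (N + 1) → ℝ}, (∀ c, 0 ≤ g c) → ∀ {b : Literature.MathematicalPhysics.KineticTheory.V3 × Literature.MathematicalPhysics.KineticTheory.V3 → ℝ}, Measurable b → (∀ p, 0 ≤ b p) → (∀ (y : Literature.Analysis.FluidPDE.Config (N + 1) (Fin 3) Literature.MathematicalPhysics.KineticTheory.T3) (t : ℝ) (k l : Fin (N + 1)), k ≠ l → g (Literature.Analysis.FluidPDE.HardSphereCollisionRecord.ofConfig (Literature.Analysis.FluidPDE.Torus.geometry (Fin 3)) (Literature.MathematicalPhysics.KineticTheory.hsDiameter σ N) y t k l) ≤ b ((y k).2, (y l).2)) → ∀ {J : ℝ}, ∫⁻ p, ENNReal.ofReal ‖p.2 - p.1‖ * ENNReal.ofReal (b p) ∂(γ.prod γ) ≤ ENNReal.ofReal J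 → ∀ {κ : ℝ}, 0 ≤ κ → κ * (4 * C * w * ((N + 1 : ℕ) : ℝ) ^ 2 * Literature.MathematicalPhysics.KineticTheory.hsDiameter σ N ^ 2 * J) ≤ (N : ℝ) + 1 → ∫⁻ z, ENNReal.ofReal (((N : ℝ) + 1)⁻¹ * ∑ i : Fin (N + 1), Set.indicator {y : ℝ | 0 < y} (fun y => y) (κ * Φ.collisionSum (Set.Ioc s₁ (s₁ + w)) (fun c => if c.fst = i then g c else 0) z)) ∂P ≤ ENNReal.ofReal 1 := by
  intro σ hσ N Φ P hP s₁ w hw C hC γ _ henv g hg0 b hbm hb0 hgb J hJ κ hκ0 hκ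
  have hN : (0 : ℝ) < (N : ℝ) + 1 := by positivity
  have hmean := CollisionEnergyExchangeMeanBound.lintegral_windowCollisionSum_le_of_pairEnvelope hσ Φ P hP s₁
    hw hC γ henv hbm
  have hgood : ∀ᵐ z ∂P, z ∈ Φ.good := mem_ae_iff.2 hP
  have hA0 : ∀ (i : Fin (N + 1)) (z : Config (N + 1) (Fin 3) T3),
      0 ≤ Φ.collisionSum (Ioc s₁ (s₁ + w)) (fun c => if c.fst = i then g c else 0) z := fun i z =>
    collisionSum_nonneg' Φ (fun c => by
      split_ifs
      exacts [hg0 c, le_rfl]) _ z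
  have hind : ∀ x : ℝ, 0 ≤ x → Set.indicator {y : ℝ | 0 < y} (fun y => y) x = x := fun x hx => by
    by_cases h : 0 < x
    · exact Set.indicator_of_mem (show x ∈ {y : ℝ | 0 < y} from h) _
    · rw [Set.indicator_of_notMem (show x ∉ {y : ℝ | 0 < y} from h)]
      linarith
  have hc0 : 0 ≤ 4 * C * w * ((N + 1 : ℕ) : ℝ) ^ 2 * hsDiameter σ N ^ 2 := by positivity
  have hpt : ∀ z, ENNReal.ofReal (((N : ℝ) + 1)⁻¹ * ∑ i : Fin (N + 1),
      Set.indicator {y : ℝ | 0 < y} (fun y => y)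
        (κ * Φ.collisionSum (Ioc s₁ (s₁ + w)) (fun c => if c.fst = i then g c else 0) z)) =
      ENNReal.ofReal (((N : ℝ) + 1)⁻¹ * κ) * ENNReal.ofReal (∑ i : Fin (N + 1),
        Φ.collisionSum (Ioc s₁ (s₁ + w)) (fun c => if c.fst = i then g c else 0) z) := by
    intro z
    rw [← ENNReal.ofReal_mul (by positivity), Finset.mul_sum, Finset.mul_sum]
    congr 1
    refine Finset.sum_congr rfl fun i _ => ?_
    rw [hind _ (mul_nonneg hκ0 (hA0 i z))]
    ring
  calc ∫⁻ z, ENNReal.ofReal (((N : ℝ) + 1)⁻¹ * ∑ i : Fin (N + 1),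
        Set.indicator {y : ℝ | 0 < y} (fun y => y)
          (κ * Φ.collisionSum (Ioc s₁ (s₁ + w)) (fun c => if c.fst = i then g c else 0) z)) ∂P
      = ENNReal.ofReal (((N : ℝ) + 1)⁻¹ * κ) * ∫⁻ z, ENNReal.ofReal (∑ i : Fin (N + 1),
          Φ.collisionSum (Ioc s₁ (s₁ + w)) (fun c => if c.fst = i then g c else 0) z) ∂P := by
        rw [lintegral_congr hpt, lintegral_const_mul' _ _ ENNReal.ofReal_ne_top]
    _ ≤ ENNReal.ofReal (((N : ℝ) + 1)⁻¹ * κ) *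
          (ENNReal.ofReal (4 * C * w * ((N + 1 : ℕ) : ℝ) ^ 2 * hsDiameter σ N ^ 2) * ENNReal.ofReal J) := by
        gcongr
        calc ∫⁻ z, ENNReal.ofReal (∑ i : Fin (N + 1),
              Φ.collisionSum (Ioc s₁ (s₁ + w)) (fun c => if c.fst = i then g c else 0) z) ∂P
            ≤ _ := lintegral_mono_ae (hgood.mono fun z hz => ofReal_sum_collisionSum_le_finsum_mark Φ hz hb0 hgb hw.le)
          _ ≤ _ := hmean
          _ ≤ _ := mul_le_mul' le_rfl hJ
    _ = ENNReal.ofReal (((N : ℝ) + 1)⁻¹ * (κ * (4 * C * w * ((N + 1 : ℕ) : ℝ) ^ 2 * hsDiameter σ N ^ 2 * J))) := by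
        rw [← ENNReal.ofReal_mul hc0, ← ENNReal.ofReal_mul (by positivity)]
        ring_nf
    _ ≤ ENNReal.ofReal 1 := ENNReal.ofReal_le_ofReal (by
        rw [inv_mul_le_iff₀ hN, mul_one]
        exact hκ)


end Summit.AtomisticToContinuum.HydrodynamicLimit.Theorems.LTEInBand

end
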